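import Summits.Ventures.CertifiedManyBodySolver.Upper.BlochDressedCellBound
import Literature.MathematicalPhysics.QuantumLattice.HartreeFockQuasiFreeCertificate
import HarnessLib

/-!
# Ventures/CertifiedManyBodySolver — Upper/BlochDressedQFCertificate.lean

HONEST FRAMING: first certified bounds; not a superconductivity verdict; every number certified or labelled float.

THE PLAQUETTE-DRESSED TRANSLATION-INVARIANT QUASI-FREE UPPER BOUND IN THE THERMODYNAMIC LIMIT AND THE SOUNDNESS OF A
FORMAT-qfp1 CERTIFICATE (sr-mbsolver L3 engine seat E1; step D4 + the instance-facing end of the Lean route of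
eng-1/LEAN-GLUE-QF.md §4; theorem-only, no certificate value appears, nothing is claimed). The cell-form bound
`energyDensity2D_le_dressedCell` (`Upper/BlochDressedCellBound.lean`) reads the Bloch reference only through its HARMONICS
`Γ₀ σ = |k|⁻¹ Σ_κ Q σ κ`, `Γ± σ j = |k|⁻¹ Σ_κ χ_κ(± e_j) Q σ κ`; for the finitely supported kernel of
`HartreeFockQuasiFreeCertificate.lean` (pre-shrink `γ̃_σ(R)`, `R ∈ S` of radius `Rc`, `δ`-certified defect, shrink `(a_σ, b_σ)`,
shrunk kernel `γ_σ = a_σ γ̃_σ + b_σ δ_{R,0} 1`, Bloch family `Q σ κ = kernelBlock S γ_σ κ`) these are kernel entries: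
* `linkWindow_eq_harmonics` — the link window `W₁₆(Q; r, j)` written with `Γ₀, Γ₊, Γ₋` (phase `e_j` exactly across a cell face);
* `energyDensity2D_le_dressedCell_of_harmonics` — `e(t,U;n̄) ≤ re 𝒞_v(Γ)/|cell| + K'_v/(2m)² + 16|t|/(2m)` on every torus `(ℤ/2m)²`;
* **`energyDensity2D_le_dressedCell_TL`** — the same references on tori with `m` arbitrarily large ⇒ `e(t,U;n̄) ≤ re 𝒞_v(Γ)/|cell|`;
* `harmonic_kernelBlock` — without aliasing, `|k|⁻¹ Σ_κ χ_κ(ū) (kernelBlock S γ κ)_{pp'} = γ(-u)_{pp'}` for `u ∈ {0, ±e_j}`;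
* **`energyDensity2D_le_qfpCellEnergy`** — even cell `M i = 2 q i`, base counts `k₀ i ≥ Rc i + 2`, `k₀ i · M i = 2 m₀`, the kernel /
  shrink data and reader duties of `HartreeFock.energyDensity2D_le_qfCellEnergy`, and ANY cell-periodic layer `v` of number-conserving
  plaquette unitaries: `e(t,U; re Σ_σ tr γ_σ(0)/|cell|) ≤ re 𝒞_v(γ(0), γ(-e_·), γ(e_·))/|cell|` — an explicit finite expression in
  the kernel entries, the gates and the tree's `slaterRDM`, which the certificate reader evaluates exactly.
Proof: `energyDensity2D_le_dressedCell` along the tori `mult · k₀`; block spectra from `kernelBlock_shrinkKernel_posSemidef`, filling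
from `sum_trace_kernelBlock`, harmonics from character orthogonality; the finite-size terms vanish (`le_of_forall_large_torus`).
Sources: Lieb 1981 [Lieb1981]; Bach–Lieb–Solovej 1994 (2c.36), (3a.2), Thm 2.3 [BachLiebSolovej1994]. Everything proved; no definition.
-/

noncomputable section

namespace Summit.Ventures.CertifiedManyBodySolver.Upper

open Matrix Finset Filter
open Literature.MathematicalPhysics.QuantumLattice Literature.MathematicalPhysics.QuantumLattice.HartreeFock
  Literature.MathematicalPhysics.QuantumLattice.ThermodynamicLimit HeisenbergTL HubbardWave0 PlaquetteLUC
open scoped ComplexOrder ComplexConjugate Topology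

section Harmonics

variable {d : ℕ} {k M : Fin d → ℕ} [∀ i, NeZero (k i)] [∀ i, NeZero (M i)]

omit [∀ i, NeZero (k i)] [∀ i, NeZero (M i)] in
/-- **No aliasing from a support radius** (public form of the step in `HartreeFockQuasiFreeCertificate`): if every `R ∈ S` has
`|R i| ≤ Rc i` and `k i ≥ Rc i + 2` then `S` is not aliased by `k`. [folklore] -/
theorem noAlias_of_radius' {S : Finset (Fin d → ℤ)} {Rc : Fin d → ℕ}
    (hRc : ∀ R ∈ S, ∀ i, |R i| ≤ Rc i) (hk : ∀ i, Rc i + 2 ≤ k i) : NoAlias k S := by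
  intro R hR v hv hzero
  funext j
  have hj : ((R j - v j : ℤ) : ZMod (k j)) = 0 := by
    have := congrFun hzero j
    simpa [cellVec] using this
  rw [ZMod.intCast_zmod_eq_zero_iff_dvd] at hj
  have habs : |R j - v j| < (k j : ℤ) := by
    have h1 := hRc R hR j
    have h2 : |v j| ≤ 1 := by rcases hv j with h | h | h <;> simp [h]
    have h3 := hk j
    calc |R j - v j| ≤ |R j| + |v j| := abs_sub _ _
      _ ≤ Rc j + 1 := by linarith
      _ < (k j : ℤ) := by exact_mod_cast (by omega : Rc j + 1 < k j)
  have := Int.eq_zero_of_abs_lt_dvd hj habs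
  linarith

omit [∀ i, NeZero (M i)] in
/-- **Harmonics of a kernel's Bloch family are kernel entries** (no aliasing; `γ` vanishing outside `S`; `u` with coordinates in
`{0, ±1}`): `|k|⁻¹ Σ_κ χ_κ(ū) (kernelBlock S γ κ)_{pp'} = γ(-u)_{pp'}`. [cite: BachLiebSolovej1994, eq. (3a.2)] -/
theorem harmonic_kernelBlock {S : Finset (Fin d → ℤ)} (hS : NoAlias k S)
    (γ : (Fin d → ℤ) → Matrix (RectTorusSite M) (RectTorusSite M) ℂ) (hγS : ∀ R ∉ S, γ R = 0)
    (u : Fin d → ℤ) (hu : ∀ j, u j = 0 ∨ u j = 1 ∨ u j = -1) (p p' : RectTorusSite M) :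
    ((Fintype.card (RectTorusSite k) : ℂ))⁻¹ * ∑ κ, blockChar κ (cellVec k u) * kernelBlock S γ κ p p' = γ (-u) p p' := by
  have hadd : ∀ R : Fin d → ℤ, cellVec k (R - (-u)) = cellVec k u + cellVec k R := fun R => by
    funext i; simp [cellVec, add_comm]
  have hkey : ∑ κ : RectTorusSite k, blockChar κ (cellVec k u) * kernelBlock S γ κ p p' =
      ∑ R ∈ S, γ R p p' * ∑ κ : RectTorusSite k, blockChar κ (cellVec k (R - (-u))) := by
    simp only [kernelBlock, Matrix.sum_apply, Matrix.smul_apply, smul_eq_mul, Finset.mul_sum]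
    rw [Finset.sum_comm]
    refine Finset.sum_congr rfl fun R _ => Finset.sum_congr rfl fun κ _ => ?_
    rw [hadd, blockChar_add_right]
    ring
  -- orthogonality: only `R = -u` survives
  have hnu : ∀ j, (-u) j = 0 ∨ (-u) j = 1 ∨ (-u) j = -1 := fun j => by
    rcases hu j with h | h | h <;> simp [h]
  have hterm : ∀ R ∈ S, γ R p p' * ∑ κ : RectTorusSite k, blockChar κ (cellVec k (R - (-u))) =
      if R = -u then (Fintype.card (RectTorusSite k) : ℂ) * γ R p p' else 0 := by
    intro R hR
    rw [sum_blockChar_left]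
    by_cases h : R = -u
    · rw [if_pos (by rw [h, sub_self]; funext i; simp [cellVec]), if_pos h, mul_comm]
    · rw [if_neg (fun h0 => h (hS R hR (-u) hnu h0)), if_neg h, mul_zero]
  rw [hkey, Finset.sum_congr rfl hterm, Finset.sum_ite_eq']
  split_ifs with h
  · rw [← mul_assoc, inv_mul_cancel₀ card_cells_ne_zero, one_mul]
  · rw [hγS (-u) h, mul_zero]; rfl

end Harmonics

/-! ### The thermodynamic limit through the harmonics, and the certificate theorem -/

section Certificate

variable {M : Fin 2 → ℕ} [∀ i, NeZero (M i)] {q : Fin 2 → ℕ}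

omit [∀ i, NeZero (M i)] in
/-- **The link window in harmonics.** With `Γ₀ σ = |k|⁻¹ Σ_κ Q σ κ`, `Γ₊ σ j = |k|⁻¹ Σ_κ χ_κ(e_j) Q σ κ`, `Γ₋ σ j = |k|⁻¹ Σ_κ χ_κ(-e_j) Q σ κ`
(entrywise), the link window `W₁₆(Q; r, j)` of `Upper/BlochDressedPeriodic.lean` is: `Γ₀` between two sites of the same plaquette or when
the link stays inside the cell, `Γ₊` (first site in `c + e_j`, second in `c`) / `Γ₋` (the other way round) when the link crosses the cell
face `r_j + 1 = q_j`. [cite: BachLiebSolovej1994, eq. (3a.2)] -/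
theorem linkWindow_eq_harmonics {k : Fin 2 → ℕ} [∀ i, NeZero (k i)]
    (Q : Fin 2 → RectTorusSite k → Matrix (RectTorusSite M) (RectTorusSite M) ℂ)
    (Γ₀ : Fin 2 → Matrix (RectTorusSite M) (RectTorusSite M) ℂ) (Γp Γm : Fin 2 → Fin 2 → Matrix (RectTorusSite M) (RectTorusSite M) ℂ)
    (hΓ₀ : ∀ σ p p', ((Fintype.card (RectTorusSite k) : ℂ))⁻¹ * ∑ κ, Q σ κ p p' = Γ₀ σ p p')
    (hΓp : ∀ σ j p p', ((Fintype.card (RectTorusSite k) : ℂ))⁻¹ * ∑ κ, blockChar κ (Pi.single j 1) * Q σ κ p p' = Γp σ j p p')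
    (hΓm : ∀ σ j p p', ((Fintype.card (RectTorusSite k) : ℂ))⁻¹ * ∑ κ, blockChar κ (-Pi.single j 1) * Q σ κ p p' = Γm σ j p p')
    (r : (i : Fin 2) → Fin (q i)) (j : Fin 2) :
    (Matrix.of fun o o' : Orb (Fin 2 ×ₗ FermionTorus 2 2) => if (ofLex o).2 = (ofLex o').2 then
        ((Fintype.card (RectTorusSite k) : ℂ))⁻¹ * ∑ κ, blockChar κ
          ((if (ofLex (ofLex o).1).1 = 0 then (0 : RectTorusSite k) else if (r j : ℕ) + 1 < q j then 0 else Pi.single j 1) -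
            (if (ofLex (ofLex o').1).1 = 0 then (0 : RectTorusSite k) else if (r j : ℕ) + 1 < q j then 0 else Pi.single j 1)) *
          Q (ofLex o).2 κ
            (fun i => (((ofLex (ofLex (ofLex o).1).2 i : ℕ) + 2 * (if (ofLex (ofLex o).1).1 = 0 then (r i : ℕ) else
              if i = j then ((r j : ℕ) + 1) % q j else (r i : ℕ)) : ℕ) : ZMod (M i)))
            (fun i => (((ofLex (ofLex (ofLex o').1).2 i : ℕ) + 2 * (if (ofLex (ofLex o').1).1 = 0 then (r i : ℕ) else
              if i = j then ((r j : ℕ) + 1) % q j else (r i : ℕ)) : ℕ) : ZMod (M i))) else 0) =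
      Matrix.of fun o o' : Orb (Fin 2 ×ₗ FermionTorus 2 2) => if (ofLex o).2 = (ofLex o').2 then
        (if (ofLex (ofLex o).1).1 = 0 then
            (if (ofLex (ofLex o').1).1 = 0 then Γ₀ (ofLex o).2 else if (r j : ℕ) + 1 < q j then Γ₀ (ofLex o).2 else Γm (ofLex o).2 j)
          else
            (if (ofLex (ofLex o').1).1 = 0 then (if (r j : ℕ) + 1 < q j then Γ₀ (ofLex o).2 else Γp (ofLex o).2 j) else Γ₀ (ofLex o).2))
            (fun i => (((ofLex (ofLex (ofLex o).1).2 i : ℕ) + 2 * (if (ofLex (ofLex o).1).1 = 0 then (r i : ℕ) else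
              if i = j then ((r j : ℕ) + 1) % q j else (r i : ℕ)) : ℕ) : ZMod (M i)))
            (fun i => (((ofLex (ofLex (ofLex o').1).2 i : ℕ) + 2 * (if (ofLex (ofLex o').1).1 = 0 then (r i : ℕ) else
              if i = j then ((r j : ℕ) + 1) % q j else (r i : ℕ)) : ℕ) : ZMod (M i))) else 0 := by
  ext o o'
  simp only [Matrix.of_apply]
  by_cases hσ : (ofLex o).2 = (ofLex o').2
  · rw [if_pos hσ, if_pos hσ]
    by_cases hb : (ofLex (ofLex o).1).1 = 0 <;> by_cases hb' : (ofLex (ofLex o').1).1 = 0 <;>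
      by_cases hf : (r j : ℕ) + 1 < q j <;>
      simp only [hb, hb', hf, if_true, if_false, sub_zero, sub_self, zero_sub, blockChar_zero_right, one_mul, hΓ₀, hΓp, hΓm]
  · rw [if_neg hσ, if_neg hσ]

/-- **Cell-form bound read through the harmonics.** `e(t,U;n̄) ≤ re 𝒞_v(Γ)/|cell| + K'_v/(2m)² + 16|t|/(2m)` for every torus `(ℤ/2m)²`
carrying a Bloch reference with spectra in `[0,1]`, filling `n̄` and harmonics `(Γ₀, Γ₊, Γ₋)`; the right-hand side depends on the
reference only through the harmonics. [cite: BachLiebSolovej1994, eq. (2c.36)] -/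
theorem energyDensity2D_le_dressedCell_of_harmonics {m : ℕ} [NeZero m] {k : Fin 2 → ℕ} [∀ i, NeZero (k i)]
    (hm : 2 ≤ m) (hkM : ∀ i, k i * M i = m * 2) (hq : ∀ i, M i = 2 * q i) (hq0 : ∀ i, 0 < q i) (t : ℝ) {U : ℝ} (hU : 0 ≤ U)
    (Q : Fin 2 → RectTorusSite k → Matrix (RectTorusSite M) (RectTorusSite M) ℂ) (hQh : ∀ σ κ, (Q σ κ).IsHermitian)
    (h0 : ∀ σ κ i, 0 ≤ (hQh σ κ).eigenvalues i) (h1 : ∀ σ κ i, (hQh σ κ).eigenvalues i ≤ 1) {nbar : ℝ}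
    (hn : (∑ σ, ∑ κ, (Q σ κ).trace).re / ((m * 2 : ℕ) : ℝ) ^ 2 = nbar) (hn0 : 0 < nbar) (hn2 : nbar < 2)
    (Γ₀ : Fin 2 → Matrix (RectTorusSite M) (RectTorusSite M) ℂ) (Γp Γm : Fin 2 → Fin 2 → Matrix (RectTorusSite M) (RectTorusSite M) ℂ)
    (hΓ₀ : ∀ σ p p', ((Fintype.card (RectTorusSite k) : ℂ))⁻¹ * ∑ κ, Q σ κ p p' = Γ₀ σ p p')
    (hΓp : ∀ σ j p p', ((Fintype.card (RectTorusSite k) : ℂ))⁻¹ * ∑ κ, blockChar κ (Pi.single j 1) * Q σ κ p p' = Γp σ j p p')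
    (hΓm : ∀ σ j p p', ((Fintype.card (RectTorusSite k) : ℂ))⁻¹ * ∑ κ, blockChar κ (-Pi.single j 1) * Q σ κ p p' = Γm σ j p p')
    (v : ((i : Fin 2) → Fin (q i)) → Matrix (Finset (Orb (FermionTorus 2 2))) (Finset (Orb (FermionTorus 2 2))) ℂ)
    (hv : ∀ r, (v r)ᴴ * v r = 1) (hvN : ∀ r, Commute totalNumberOp (v r)) :
    energyDensity2D t U nbar ≤
      ((∑ r : (i : Fin 2) → Fin (q i),
          ((∑ s : Finset (Orb (FermionTorus 2 2)), ∑ s' : Finset (Orb (FermionTorus 2 2)),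
              ((v r)ᴴ * hamiltonian plaquetteGraph t U * v r) s s' *
                slaterRDM (Matrix.of fun o o' : Orb (FermionTorus 2 2) => if (ofLex o).2 = (ofLex o').2 then
                  Γ₀ (ofLex o).2 (fun i => (((ofLex (ofLex o).1 i : ℕ) + 2 * (r i : ℕ) : ℕ) : ZMod (M i)))
                    (fun i => (((ofLex (ofLex o').1 i : ℕ) + 2 * (r i : ℕ) : ℕ) : ZMod (M i))) else 0) s s') +
            ∑ j : Fin 2, ∑ s : Finset (Orb (Fin 2 ×ₗ FermionTorus 2 2)), ∑ s' : Finset (Orb (Fin 2 ×ₗ FermionTorus 2 2)),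
              ((fermionEmbed inlCell (v r) * fermionEmbed inrCell
                    (v (fun i => ⟨(if i = j then (r i : ℕ) + 1 else (r i : ℕ)) % q i, Nat.mod_lt _ (hq0 i)⟩)))ᴴ *
                  hamiltonian (linkGraph j) t 0 *
                  (fermionEmbed inlCell (v r) * fermionEmbed inrCell
                    (v (fun i => ⟨(if i = j then (r i : ℕ) + 1 else (r i : ℕ)) % q i, Nat.mod_lt _ (hq0 i)⟩)))) s s' *
                slaterRDM (Matrix.of fun o o' : Orb (Fin 2 ×ₗ FermionTorus 2 2) => if (ofLex o).2 = (ofLex o').2 then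
                  (if (ofLex (ofLex o).1).1 = 0 then
                      (if (ofLex (ofLex o').1).1 = 0 then Γ₀ (ofLex o).2 else if (r j : ℕ) + 1 < q j then Γ₀ (ofLex o).2 else Γm (ofLex o).2 j)
                    else
                      (if (ofLex (ofLex o').1).1 = 0 then (if (r j : ℕ) + 1 < q j then Γ₀ (ofLex o).2 else Γp (ofLex o).2 j)
                        else Γ₀ (ofLex o).2))
                    (fun i => (((ofLex (ofLex (ofLex o).1).2 i : ℕ) + 2 * (if (ofLex (ofLex o).1).1 = 0 then (r i : ℕ) else
                      if i = j then ((r j : ℕ) + 1) % q j else (r i : ℕ)) : ℕ) : ZMod (M i)))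
                    (fun i => (((ofLex (ofLex (ofLex o').1).2 i : ℕ) + 2 * (if (ofLex (ofLex o').1).1 = 0 then (r i : ℕ) else
                      if i = j then ((r j : ℕ) + 1) % q j else (r i : ℕ)) : ℕ) : ZMod (M i))) else 0) s s'))).re /
          ∏ i, (M i : ℝ) +
        ((∑ r : (i : Fin 2) → Fin (q i), ∑ s : Finset (Orb (FermionTorus 2 2)), ∑ s' : Finset (Orb (FermionTorus 2 2)),
              ‖((v r)ᴴ * hamiltonian plaquetteGraph t U * v r) s s'‖) *
            (2 ^ Fintype.card (Orb (FermionTorus 2 2)) * ((Fintype.card (Orb (FermionTorus 2 2))).factorial *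
              (2 * (Fintype.card (Orb (FermionTorus 2 2)) : ℝ) ^ 2))) +
          (∑ r : (i : Fin 2) → Fin (q i), ∑ j : Fin 2,
              ∑ s : Finset (Orb (Fin 2 ×ₗ FermionTorus 2 2)), ∑ s' : Finset (Orb (Fin 2 ×ₗ FermionTorus 2 2)),
                ‖((fermionEmbed inlCell (v r) * fermionEmbed inrCell
                      (v (fun i => ⟨(if i = j then (r i : ℕ) + 1 else (r i : ℕ)) % q i, Nat.mod_lt _ (hq0 i)⟩)))ᴴ *
                    hamiltonian (linkGraph j) t 0 *
                    (fermionEmbed inlCell (v r) * fermionEmbed inrCell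
                      (v (fun i => ⟨(if i = j then (r i : ℕ) + 1 else (r i : ℕ)) % q i, Nat.mod_lt _ (hq0 i)⟩)))) s s'‖) *
            (2 ^ Fintype.card (Orb (Fin 2 ×ₗ FermionTorus 2 2)) * ((Fintype.card (Orb (Fin 2 ×ₗ FermionTorus 2 2))).factorial *
              (2 * (Fintype.card (Orb (Fin 2 ×ₗ FermionTorus 2 2)) : ℝ) ^ 2)))) / ((m * 2 : ℕ) : ℝ) ^ 2 +
        16 * |t| / ((m * 2 : ℕ) : ℝ) := by
  subst hn
  have h := energyDensity2D_le_dressedCell hm hkM hq hq0 t hU Q hQh h0 h1 hn0 hn2 v hv hvN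
  simp_rw [linkWindow_eq_harmonics Q Γ₀ Γp Γm hΓ₀ hΓp hΓm, hΓ₀] at h
  exact h

/-- **Thermodynamic limit of a bound with vanishing finite-size corrections**: if for arbitrarily large `m` one has
`e ≤ C + K/(2m)² + 16|t|/(2m)`, then `e ≤ C`. [folklore] -/
theorem le_of_forall_large_torus {e C K t : ℝ}
    (h : ∀ N : ℕ, ∃ m : ℕ, N ≤ m ∧ e ≤ C + K / ((m * 2 : ℕ) : ℝ) ^ 2 + 16 * |t| / ((m * 2 : ℕ) : ℝ)) : e ≤ C := by
  choose mN hmN hle using h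
  have hg : Tendsto (fun N : ℕ => ((mN N * 2 : ℕ) : ℝ)) atTop atTop := by
    refine tendsto_natCast_atTop_atTop.comp ?_
    exact Filter.tendsto_atTop_mono (fun N => by have := hmN N; show id N ≤ mN N * 2; rw [id_eq]; omega) Filter.tendsto_id
  have h1 : Tendsto (fun N : ℕ => K / ((mN N * 2 : ℕ) : ℝ) ^ 2) atTop (𝓝 0) :=
    tendsto_const_nhds.div_atTop ((tendsto_pow_atTop two_ne_zero).comp hg)
  have h2 : Tendsto (fun N : ℕ => 16 * |t| / ((mN N * 2 : ℕ) : ℝ)) atTop (𝓝 0) := tendsto_const_nhds.div_atTop hg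
  have hlim : Tendsto (fun N : ℕ => C + K / ((mN N * 2 : ℕ) : ℝ) ^ 2 + 16 * |t| / ((mN N * 2 : ℕ) : ℝ)) atTop (𝓝 (C + 0 + 0)) :=
    (tendsto_const_nhds.add h1).add h2
  rw [add_zero, add_zero] at hlim
  exact ge_of_tendsto' hlim fun N => hle N

/-- **The plaquette-dressed translation-invariant quasi-free upper bound (thermodynamic limit).** Fix an even cell `M i = 2 q i`, a
cell-periodic layer `v` of number-conserving plaquette unitaries, harmonics `(Γ₀, Γ₊, Γ₋)` and a filling `n̄ ∈ (0,2)`. If tori `(ℤ/2m)²`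
with `m` arbitrarily large carry Bloch references (`k i · M i = 2m` cells, blocks with spectra in `[0,1]`) of filling `n̄` whose harmonics
are `(Γ₀, Γ₊, Γ₋)`, then `e(t,U;n̄) ≤ re 𝒞_v(Γ)/|cell|` — the dressed cell energy per site. This is Lieb's variational principle for
the quasi-free reference state dressed by one layer of local unitaries, with the reference entering only through finitely many cell
matrices. [cite: BachLiebSolovej1994, eq. (2c.36)] -/
theorem energyDensity2D_le_dressedCell_TL (hq : ∀ i, M i = 2 * q i) (hq0 : ∀ i, 0 < q i) (t : ℝ) {U : ℝ} (hU : 0 ≤ U)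
    {nbar : ℝ} (hn0 : 0 < nbar) (hn2 : nbar < 2)
    (Γ₀ : Fin 2 → Matrix (RectTorusSite M) (RectTorusSite M) ℂ) (Γp Γm : Fin 2 → Fin 2 → Matrix (RectTorusSite M) (RectTorusSite M) ℂ)
    (v : ((i : Fin 2) → Fin (q i)) → Matrix (Finset (Orb (FermionTorus 2 2))) (Finset (Orb (FermionTorus 2 2))) ℂ)
    (hv : ∀ r, (v r)ᴴ * v r = 1) (hvN : ∀ r, Commute totalNumberOp (v r))
    (hseq : ∀ N : ℕ, ∃ (m : ℕ) (k : Fin 2 → ℕ) (_ : NeZero m) (_ : ∀ i, NeZero (k i)) (_ : 2 ≤ m) (_ : N ≤ m)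
      (_ : ∀ i, k i * M i = m * 2) (Q : Fin 2 → RectTorusSite k → Matrix (RectTorusSite M) (RectTorusSite M) ℂ)
      (hQh : ∀ σ κ, (Q σ κ).IsHermitian),
      (∀ σ κ i, 0 ≤ (hQh σ κ).eigenvalues i) ∧ (∀ σ κ i, (hQh σ κ).eigenvalues i ≤ 1) ∧
      (∑ σ, ∑ κ, (Q σ κ).trace).re / ((m * 2 : ℕ) : ℝ) ^ 2 = nbar ∧
      (∀ σ p p', ((Fintype.card (RectTorusSite k) : ℂ))⁻¹ * ∑ κ, Q σ κ p p' = Γ₀ σ p p') ∧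
      (∀ σ j p p', ((Fintype.card (RectTorusSite k) : ℂ))⁻¹ * ∑ κ, blockChar κ (Pi.single j 1) * Q σ κ p p' = Γp σ j p p') ∧
      (∀ σ j p p', ((Fintype.card (RectTorusSite k) : ℂ))⁻¹ * ∑ κ, blockChar κ (-Pi.single j 1) * Q σ κ p p' = Γm σ j p p')) :
    energyDensity2D t U nbar ≤
      (∑ r : (i : Fin 2) → Fin (q i),
          ((∑ s : Finset (Orb (FermionTorus 2 2)), ∑ s' : Finset (Orb (FermionTorus 2 2)),
              ((v r)ᴴ * hamiltonian plaquetteGraph t U * v r) s s' *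
                slaterRDM (Matrix.of fun o o' : Orb (FermionTorus 2 2) => if (ofLex o).2 = (ofLex o').2 then
                  Γ₀ (ofLex o).2 (fun i => (((ofLex (ofLex o).1 i : ℕ) + 2 * (r i : ℕ) : ℕ) : ZMod (M i)))
                    (fun i => (((ofLex (ofLex o').1 i : ℕ) + 2 * (r i : ℕ) : ℕ) : ZMod (M i))) else 0) s s') +
            ∑ j : Fin 2, ∑ s : Finset (Orb (Fin 2 ×ₗ FermionTorus 2 2)), ∑ s' : Finset (Orb (Fin 2 ×ₗ FermionTorus 2 2)),
              ((fermionEmbed inlCell (v r) * fermionEmbed inrCell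
                    (v (fun i => ⟨(if i = j then (r i : ℕ) + 1 else (r i : ℕ)) % q i, Nat.mod_lt _ (hq0 i)⟩)))ᴴ *
                  hamiltonian (linkGraph j) t 0 *
                  (fermionEmbed inlCell (v r) * fermionEmbed inrCell
                    (v (fun i => ⟨(if i = j then (r i : ℕ) + 1 else (r i : ℕ)) % q i, Nat.mod_lt _ (hq0 i)⟩)))) s s' *
                slaterRDM (Matrix.of fun o o' : Orb (Fin 2 ×ₗ FermionTorus 2 2) => if (ofLex o).2 = (ofLex o').2 then
                  (if (ofLex (ofLex o).1).1 = 0 then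
                      (if (ofLex (ofLex o').1).1 = 0 then Γ₀ (ofLex o).2 else if (r j : ℕ) + 1 < q j then Γ₀ (ofLex o).2 else Γm (ofLex o).2 j)
                    else
                      (if (ofLex (ofLex o').1).1 = 0 then (if (r j : ℕ) + 1 < q j then Γ₀ (ofLex o).2 else Γp (ofLex o).2 j)
                        else Γ₀ (ofLex o).2))
                    (fun i => (((ofLex (ofLex (ofLex o).1).2 i : ℕ) + 2 * (if (ofLex (ofLex o).1).1 = 0 then (r i : ℕ) else
                      if i = j then ((r j : ℕ) + 1) % q j else (r i : ℕ)) : ℕ) : ZMod (M i)))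
                    (fun i => (((ofLex (ofLex (ofLex o').1).2 i : ℕ) + 2 * (if (ofLex (ofLex o').1).1 = 0 then (r i : ℕ) else
                      if i = j then ((r j : ℕ) + 1) % q j else (r i : ℕ)) : ℕ) : ZMod (M i))) else 0) s s')).re /
          ∏ i, (M i : ℝ) := by
  refine le_of_forall_large_torus (t := t)
    (K := (∑ r : (i : Fin 2) → Fin (q i), ∑ s : Finset (Orb (FermionTorus 2 2)), ∑ s' : Finset (Orb (FermionTorus 2 2)),
              ‖((v r)ᴴ * hamiltonian plaquetteGraph t U * v r) s s'‖) *
            (2 ^ Fintype.card (Orb (FermionTorus 2 2)) * ((Fintype.card (Orb (FermionTorus 2 2))).factorial *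
              (2 * (Fintype.card (Orb (FermionTorus 2 2)) : ℝ) ^ 2))) +
          (∑ r : (i : Fin 2) → Fin (q i), ∑ j : Fin 2,
              ∑ s : Finset (Orb (Fin 2 ×ₗ FermionTorus 2 2)), ∑ s' : Finset (Orb (Fin 2 ×ₗ FermionTorus 2 2)),
                ‖((fermionEmbed inlCell (v r) * fermionEmbed inrCell
                      (v (fun i => ⟨(if i = j then (r i : ℕ) + 1 else (r i : ℕ)) % q i, Nat.mod_lt _ (hq0 i)⟩)))ᴴ *
                    hamiltonian (linkGraph j) t 0 *
                    (fermionEmbed inlCell (v r) * fermionEmbed inrCell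
                      (v (fun i => ⟨(if i = j then (r i : ℕ) + 1 else (r i : ℕ)) % q i, Nat.mod_lt _ (hq0 i)⟩)))) s s'‖) *
            (2 ^ Fintype.card (Orb (Fin 2 ×ₗ FermionTorus 2 2)) * ((Fintype.card (Orb (Fin 2 ×ₗ FermionTorus 2 2))).factorial *
              (2 * (Fintype.card (Orb (Fin 2 ×ₗ FermionTorus 2 2)) : ℝ) ^ 2)))) fun N => ?_
  obtain ⟨m, k, hmz, hkz, hm, hNm, hkM, Q, hQh, h0, h1, hn, hΓ₀, hΓp, hΓm⟩ := hseq N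
  exact ⟨m, hNm, energyDensity2D_le_dressedCell_of_harmonics hm hkM hq hq0 t hU Q hQh h0 h1 hn hn0 hn2 Γ₀ Γp Γm hΓ₀ hΓp hΓm v hv hvN⟩

omit [∀ i, NeZero (M i)] in
/-- `cellVec k e_j = e_j`. [folklore] -/
theorem cellVec_single' {k : Fin 2 → ℕ} (j : Fin 2) : cellVec k (Pi.single j (1 : ℤ)) = Pi.single j 1 := by
  funext i
  by_cases h : i = j
  · subst h; simp [cellVec]
  · simp [cellVec, Pi.single_eq_of_ne h]

omit [∀ i, NeZero (M i)] in
/-- `cellVec k (-e_j) = -e_j`. [folklore] -/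
theorem cellVec_neg_single' {k : Fin 2 → ℕ} (j : Fin 2) : cellVec k (-Pi.single j (1 : ℤ)) = -Pi.single j 1 := by
  funext i
  by_cases h : i = j
  · subst h; simp [cellVec]
  · simp [cellVec, Pi.single_eq_of_ne h]

/-- **Soundness of a plaquette-dressed translation-invariant quasi-free certificate (FORMAT-qfp1).** Even cell `M i = 2 q i`; base
cell counts `k₀ i ≥ Rc i + 2` with `k₀ i · M i = 2 m₀`; kernel data and reader duties exactly as in
`HartreeFock.energyDensity2D_le_qfCellEnergy` (support `S` of radius `Rc`, symmetric, `0 ∈ S`; pre-shrink kernels `γ̃_σ` vanishing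
outside `S` with `γ̃_σ(-R) = γ̃_σ(R)ᴴ`; Frobenius bounds `c_σ(T)` of the defect kernel; shrink parameters `a_σ ≥ 0`, `a_σ Σ c_σ ≤ b_σ`,
`a_σ(1 + Σ c_σ) + b_σ ≤ 1`; density in `(0,2)`), and any cell-periodic layer `v` of number-conserving plaquette unitaries. Then, with the
shrunk kernel `γ_σ = a_σ γ̃_σ + b_σ δ_{R,0} 1`:
`e(t,U; re Σ_σ tr γ_σ(0) / |cell|) ≤ re 𝒞_v(γ(0), γ(-e_·), γ(e_·)) / |cell|`, the dressed cell energy of `Upper/BlochDressedTL.lean` on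
the kernel entries (harmonics `Γ₀ σ = γ_σ(0)`, `Γ₊ σ j = γ_σ(-e_j)`, `Γ₋ σ j = γ_σ(e_j)`). [cite: BachLiebSolovej1994, eq. (2c.36)] -/
theorem energyDensity2D_le_qfpCellEnergy (hq : ∀ i, M i = 2 * q i) (hq0 : ∀ i, 0 < q i)
    (k₀ : Fin 2 → ℕ) (m₀ : ℕ) (hk₀ : ∀ i, k₀ i * M i = m₀ * 2) (t : ℝ) {U : ℝ} (hU : 0 ≤ U)
    (S : Finset (Fin 2 → ℤ)) (Rc : Fin 2 → ℕ) (hRc : ∀ R ∈ S, ∀ i, |R i| ≤ Rc i) (hkRc : ∀ i, Rc i + 2 ≤ k₀ i)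
    (h0S : (0 : Fin 2 → ℤ) ∈ S) (hSneg : ∀ R ∈ S, -R ∈ S)
    (γt : Fin 2 → (Fin 2 → ℤ) → Matrix (RectTorusSite M) (RectTorusSite M) ℂ)
    (hγtS : ∀ σ, ∀ R ∉ S, γt σ R = 0) (hγt : ∀ σ R, γt σ (-R) = (γt σ R)ᴴ)
    (c : Fin 2 → (Fin 2 → ℤ) → ℝ)
    (hc : ∀ σ, ∀ T ∈ defectSupport S, Real.sqrt (∑ i, ∑ j, ‖defectKernel S (γt σ) T i j‖ ^ 2) ≤ c σ T)
    (a b : Fin 2 → ℝ) (ha : ∀ σ, 0 ≤ a σ) (hab : ∀ σ, a σ * (∑ T ∈ defectSupport S, c σ T) ≤ b σ)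
    (hab1 : ∀ σ, a σ * (1 + ∑ T ∈ defectSupport S, c σ T) + b σ ≤ 1)
    (hn0 : 0 < (∑ σ, (shrinkKernel (γt σ) (a σ) (b σ) 0).trace).re / ∏ i, (M i : ℝ))
    (hn2 : (∑ σ, (shrinkKernel (γt σ) (a σ) (b σ) 0).trace).re / ∏ i, (M i : ℝ) < 2)
    (v : ((i : Fin 2) → Fin (q i)) → Matrix (Finset (Orb (FermionTorus 2 2))) (Finset (Orb (FermionTorus 2 2))) ℂ)
    (hv : ∀ r, (v r)ᴴ * v r = 1) (hvN : ∀ r, Commute totalNumberOp (v r)) :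
    energyDensity2D t U ((∑ σ, (shrinkKernel (γt σ) (a σ) (b σ) 0).trace).re / ∏ i, (M i : ℝ)) ≤
      (∑ r : (i : Fin 2) → Fin (q i),
          ((∑ s : Finset (Orb (FermionTorus 2 2)), ∑ s' : Finset (Orb (FermionTorus 2 2)),
              ((v r)ᴴ * hamiltonian plaquetteGraph t U * v r) s s' *
                slaterRDM (Matrix.of fun o o' : Orb (FermionTorus 2 2) => if (ofLex o).2 = (ofLex o').2 then
                  shrinkKernel (γt (ofLex o).2) (a (ofLex o).2) (b (ofLex o).2) 0
                    (fun i => (((ofLex (ofLex o).1 i : ℕ) + 2 * (r i : ℕ) : ℕ) : ZMod (M i)))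
                    (fun i => (((ofLex (ofLex o').1 i : ℕ) + 2 * (r i : ℕ) : ℕ) : ZMod (M i))) else 0) s s') +
            ∑ j : Fin 2, ∑ s : Finset (Orb (Fin 2 ×ₗ FermionTorus 2 2)), ∑ s' : Finset (Orb (Fin 2 ×ₗ FermionTorus 2 2)),
              ((fermionEmbed inlCell (v r) * fermionEmbed inrCell
                    (v (fun i => ⟨(if i = j then (r i : ℕ) + 1 else (r i : ℕ)) % q i, Nat.mod_lt _ (hq0 i)⟩)))ᴴ *
                  hamiltonian (linkGraph j) t 0 *
                  (fermionEmbed inlCell (v r) * fermionEmbed inrCell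
                    (v (fun i => ⟨(if i = j then (r i : ℕ) + 1 else (r i : ℕ)) % q i, Nat.mod_lt _ (hq0 i)⟩)))) s s' *
                slaterRDM (Matrix.of fun o o' : Orb (Fin 2 ×ₗ FermionTorus 2 2) => if (ofLex o).2 = (ofLex o').2 then
                  (if (ofLex (ofLex o).1).1 = 0 then
                      (if (ofLex (ofLex o').1).1 = 0 then shrinkKernel (γt (ofLex o).2) (a (ofLex o).2) (b (ofLex o).2) 0
                        else if (r j : ℕ) + 1 < q j then shrinkKernel (γt (ofLex o).2) (a (ofLex o).2) (b (ofLex o).2) 0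
                        else shrinkKernel (γt (ofLex o).2) (a (ofLex o).2) (b (ofLex o).2) (Pi.single j 1))
                    else
                      (if (ofLex (ofLex o').1).1 = 0 then
                          (if (r j : ℕ) + 1 < q j then shrinkKernel (γt (ofLex o).2) (a (ofLex o).2) (b (ofLex o).2) 0
                            else shrinkKernel (γt (ofLex o).2) (a (ofLex o).2) (b (ofLex o).2) (-Pi.single j 1))
                        else shrinkKernel (γt (ofLex o).2) (a (ofLex o).2) (b (ofLex o).2) 0))
                    (fun i => (((ofLex (ofLex (ofLex o).1).2 i : ℕ) + 2 * (if (ofLex (ofLex o).1).1 = 0 then (r i : ℕ) else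
                      if i = j then ((r j : ℕ) + 1) % q j else (r i : ℕ)) : ℕ) : ZMod (M i)))
                    (fun i => (((ofLex (ofLex (ofLex o').1).2 i : ℕ) + 2 * (if (ofLex (ofLex o').1).1 = 0 then (r i : ℕ) else
                      if i = j then ((r j : ℕ) + 1) % q j else (r i : ℕ)) : ℕ) : ZMod (M i))) else 0) s s')).re /
          ∏ i, (M i : ℝ) := by
  refine energyDensity2D_le_dressedCell_TL hq hq0 t hU hn0 hn2 (fun σ => shrinkKernel (γt σ) (a σ) (b σ) 0)
    (fun σ j => shrinkKernel (γt σ) (a σ) (b σ) (-Pi.single j 1)) (fun σ j => shrinkKernel (γt σ) (a σ) (b σ) (Pi.single j 1))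
    v hv hvN fun N => ?_
  -- the torus with `(N + 1) · k₀` cells in each direction
  have hk₀pos : ∀ i, 0 < k₀ i := fun i => by have := hkRc i; omega
  have hM0 : 2 ≤ M 0 := by rw [hq 0]; have := hq0 0; omega
  have hm₀ : 2 ≤ m₀ := by
    have h1 := hk₀ 0
    have h2 : 2 ≤ k₀ 0 := by have := hkRc 0; omega
    nlinarith
  haveI hmz : NeZero ((N + 1) * m₀) := ⟨Nat.mul_ne_zero (Nat.succ_ne_zero N) (by omega)⟩
  haveI hkz : ∀ i, NeZero ((N + 1) * k₀ i) := fun i => ⟨Nat.mul_ne_zero (Nat.succ_ne_zero N) (hk₀pos i).ne'⟩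
  have hkM : ∀ i, (N + 1) * k₀ i * M i = (N + 1) * m₀ * 2 := fun i => by rw [mul_assoc, hk₀ i, mul_assoc]
  have hS : NoAlias (fun i => (N + 1) * k₀ i) S :=
    noAlias_of_radius' hRc fun i => le_trans (hkRc i) (Nat.le_mul_of_pos_left (k₀ i) (Nat.succ_pos N))
  have hγS : ∀ σ, ∀ R ∉ S, shrinkKernel (γt σ) (a σ) (b σ) R = 0 := fun σ =>
    shrinkKernel_eq_zero S (γt σ) h0S (hγtS σ) (a σ) (b σ)
  have hQ01 : ∀ σ (κ : RectTorusSite (fun i => (N + 1) * k₀ i)),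
      (kernelBlock S (shrinkKernel (γt σ) (a σ) (b σ)) κ).PosSemidef ∧ (1 - kernelBlock S (shrinkKernel (γt σ) (a σ) (b σ)) κ).PosSemidef :=
    fun σ κ => kernelBlock_shrinkKernel_posSemidef S (γt σ) h0S hSneg (hγt σ) (c σ) (hc σ) (ha σ) (hab σ) (hab1 σ) κ
  refine ⟨(N + 1) * m₀, fun i => (N + 1) * k₀ i, hmz, hkz, le_trans hm₀ (Nat.le_mul_of_pos_left m₀ (Nat.succ_pos N)),
    le_trans (Nat.le_succ N) (Nat.le_mul_of_pos_right (N + 1) (by omega)), hkM,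
    fun σ κ => kernelBlock S (shrinkKernel (γt σ) (a σ) (b σ)) κ, fun σ κ => (hQ01 σ κ).1.isHermitian,
    fun σ κ i => eigenvalues_nonneg_of_loewner _ (hQ01 σ κ).1 i, fun σ κ i => eigenvalues_le_one_of_loewner _ (hQ01 σ κ).2 i,
    ?_, ?_, ?_, ?_⟩
  · -- the filling
    have htr : ∑ σ, ∑ κ : RectTorusSite (fun i => (N + 1) * k₀ i), (kernelBlock S (shrinkKernel (γt σ) (a σ) (b σ)) κ).trace =
        (Fintype.card (RectTorusSite (fun i => (N + 1) * k₀ i)) : ℂ) * ∑ σ, (shrinkKernel (γt σ) (a σ) (b σ) 0).trace := by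
      rw [Finset.mul_sum]
      exact Finset.sum_congr rfl fun σ _ => sum_trace_kernelBlock S _ hS (hγS σ)
    rw [htr, ← card_cells_mul_prod_side hkM,
      show ((Fintype.card (RectTorusSite (fun i => (N + 1) * k₀ i)) : ℂ)) =
        (((Fintype.card (RectTorusSite (fun i => (N + 1) * k₀ i)) : ℝ)) : ℂ) by norm_cast, Complex.re_ofReal_mul]
    have hK : (0 : ℝ) < (Fintype.card (RectTorusSite (fun i => (N + 1) * k₀ i)) : ℝ) := by exact_mod_cast Fintype.card_pos
    field_simp
  · intro σ p p'
    have h := harmonic_kernelBlock hS (shrinkKernel (γt σ) (a σ) (b σ)) (hγS σ) 0 (fun j => Or.inl rfl) p p'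
    simpa only [neg_zero, show cellVec (fun i => (N + 1) * k₀ i) (0 : Fin 2 → ℤ) = 0 by funext i; simp [cellVec],
      blockChar_zero_right, one_mul] using h
  · intro σ j p p'
    have h := harmonic_kernelBlock hS (shrinkKernel (γt σ) (a σ) (b σ)) (hγS σ) (Pi.single j 1)
      (fun i => by by_cases hij : i = j <;> simp [hij]) p p'
    simpa only [cellVec_single'] using h
  · intro σ j p p'
    have h := harmonic_kernelBlock hS (shrinkKernel (γt σ) (a σ) (b σ)) (hγS σ) (-Pi.single j 1)
      (fun i => by by_cases hij : i = j <;> simp [hij]) p p'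
    simpa only [cellVec_neg_single', neg_neg] using h

end Certificate

end Summit.Ventures.CertifiedManyBodySolver.Upper
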